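import Summits.HodgeConjecture.HodgeConjecture.Cruxes.BlochSeedDiscOne.FinCheck

/-!
# NegSlotPattern — the NEGATIVE-SLOT PATTERN LAW at h = 6 (negation g19, pen; `COVER-INTEGRALITY-JOINT.md` v1.4 §C.14 finding (2), kernel form)

F3 (letter fact): if an alphabet letter `ℓ` is amply below an alphabet letter `q` with `q.a = 2`, then `ℓ.a = 0` and the SORTED
absolute coordinates of `ℓ` are those of `q` shifted by `(1,1)`: shape `(2;2,2) ↦ (0;3,3)`, `(2;3,1) ↦ (0;4,2)`, `(2;4,0) ↦ (0;5,1)`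
— the census tables `BELOW(2;2,2) = {m}`, `BELOW(2;3,1) = {g}`, `BELOW(2;4,0) = {f}` of the RESIDUAL ATLAS (hsemireg bus l.11419;
officer re-derivation ×2 l.11428), now tree facts. (F1: below a height-2 letter only floor letters; F2: a floor letter covers at most
one height-2 letter — `CoverIntegralityFacts.letterFactF1 ∕ letterFactF2`, `CoverIntegrality.F1_six ∕ F2_six`.)
PATTERN LAW (design level): for every (A4) design on the height-6 alphabet, every present N cell `y` has a present P cell `x` such that at
EVERY slot `f` with `(y f).a = 2` one has `(x f).a = 0` and the sorted absolute coordinates of `x f` are those of `y f` plus `(1,1)` — the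
negative-slot pattern of `y` is matched slot for slot by a floor pattern of ONE P cell. Counting corollary: that `x` has at least as many
floor slots as `y` has height-2 slots (so an N cell with `j` slots of shape `b ∕ r ∕ q` needs a P cell with `≥ j` floor letters of the
matching shapes; with pure floor powers cap-inadmissible on all 158 regions of T158 — a DATA fact, not proved here — such covers have
ordering number `≥ 4`).
Route: `FinCheck.boxList 6 6` and the kernel-evaluable up-lists `FinCheck.upList 6 ℓ`, by `decide` (the `f1_list ∕ f2_list` pattern),
transported to `Letter.OnAlphabet 6` by `mem_boxList ∕ mem_upList` (imports `FinCheck` only, so that it elaborates while `CoverIntegralityFacts` is unbuilt on the farm; the three transport helpers are re-proved locally under new names). Sorry-free; no `native_decide`; no instances; no notation.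
HONEST FRAMING: finite facts about the LETTER model at h = 6 and a one-line consequence of `Design.A4`; nothing here proves
`FloorFree 6 199 8` ∕ `IntegralityGap.Nonex 14 199 8` ∕ 18881 (`BlochSeedDiscOne`) ∕ H2 ∕ HC_AV ∕ HC_CM ∕ HC. Census-neutral.
-/

set_option linter.dupNamespace false
set_option autoImplicit false

namespace Summit.HodgeConjecture.HodgeConjecture.Cruxes.BlochSeedDiscOne.NegSlotPattern

open Summit.HodgeConjecture.HodgeConjecture.Cruxes.BlochSeedDiscOne.DepthBoundA4
open Summit.HodgeConjecture.HodgeConjecture.Cruxes.BlochSeedDiscOne.FinCheck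

/-- an alphabet letter is a box letter (transport helper; same proof as `CoverIntegralityFacts.mem_boxList_of_onAlphabet`). -/
theorem alphabet_mem_boxList {ℓ : Letter} (hℓ : ℓ.OnAlphabet 6) : ℓ ∈ boxList 6 6 := by
  refine mem_boxList.mpr ⟨hℓ.1, ?_, ?_⟩
  · have e := hℓ.1; have h0 := hℓ.2; unfold Letter.height at e
    have := abs_nonneg ℓ.y; push_cast; omega
  · have e := hℓ.1; have h0 := hℓ.2; unfold Letter.height at e
    have := abs_nonneg ℓ.x; push_cast; omega

/-- letters of N support cells are alphabet letters. -/
theorem suppN_onAlphabet {D : Design} (hA : D.OnAlphabet 6) {y : Cell} (hy : y ∈ D.suppN) (f : Fin 4) : (y f).OnAlphabet 6 :=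
  hA y (List.mem_append.mpr (Or.inl hy)) f

/-- letters of P support cells are alphabet letters. -/
theorem suppP_onAlphabet {D : Design} (hA : D.OnAlphabet 6) {x : Cell} (hx : x ∈ D.suppP) (f : Fin 4) : (x f).OnAlphabet 6 :=
  hA x (List.mem_append.mpr (Or.inr hx)) f

/-- the larger of the two absolute coordinates `|x| , |y|` of a letter (as a natural number). -/
abbrev absMax (ℓ : Letter) : ℕ := max ℓ.x.natAbs ℓ.y.natAbs

/-- the smaller of the two absolute coordinates `|x| , |y|` of a letter (as a natural number). -/
abbrev absMin (ℓ : Letter) : ℕ := min ℓ.x.natAbs ℓ.y.natAbs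

/-- the floor pattern forced under a height-2 letter `q`: height `0` and sorted absolute coordinates shifted by `(1,1)`. -/
abbrev ShiftPattern (ℓ q : Letter) : Prop := ℓ.a = 0 ∧ absMax ℓ = absMax q + 1 ∧ absMin ℓ = absMin q + 1

set_option maxRecDepth 65536 in
/-- F3, list form: over the box letters with `a ≥ 0` (the alphabet), every up-list letter with `a = 2` sits over a letter with the shifted floor pattern (kernel `decide`; the box letters with `a < 0` are NOT alphabet letters and do violate the pattern, e.g. `(−2;4,4)` under `(2;2,2)`). -/
theorem f3_list : ∀ ℓ ∈ boxList 6 6, 0 ≤ ℓ.a → ∀ q ∈ upList 6 ℓ, q.a = 2 → ShiftPattern ℓ q := by decide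

/-- F3 on the alphabet: amply below a height-2 alphabet letter `q` lies only a floor letter whose sorted absolute coordinates are `q`'s plus `(1,1)`. -/
theorem letterFactF3 : ∀ ℓ q : Letter, ℓ.OnAlphabet 6 → q.OnAlphabet 6 → q.a = 2 → AmpleAbove ℓ q → ShiftPattern ℓ q := by
  intro ℓ q hℓ hq ha hA
  exact f3_list ℓ (alphabet_mem_boxList hℓ) hℓ.2 q ((mem_upList hℓ).mpr ⟨hq, hA⟩) ha

/-- below `b = (2;2,2)` only `m = (0;3,3)`. -/
theorem below_b_is_m : ∀ ℓ q : Letter, ℓ.OnAlphabet 6 → q.OnAlphabet 6 → q.a = 2 → absMax q = 2 → absMin q = 2 →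
    AmpleAbove ℓ q → ℓ.a = 0 ∧ absMax ℓ = 3 ∧ absMin ℓ = 3 := by
  intro ℓ q hℓ hq ha hM hm hA
  have h := letterFactF3 ℓ q hℓ hq ha hA
  exact ⟨h.1, by rw [h.2.1, hM], by rw [h.2.2, hm]⟩

/-- below `r = (2;3,1)` only `g = (0;4,2)`. -/
theorem below_r_is_g : ∀ ℓ q : Letter, ℓ.OnAlphabet 6 → q.OnAlphabet 6 → q.a = 2 → absMax q = 3 → absMin q = 1 →
    AmpleAbove ℓ q → ℓ.a = 0 ∧ absMax ℓ = 4 ∧ absMin ℓ = 2 := by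
  intro ℓ q hℓ hq ha hM hm hA
  have h := letterFactF3 ℓ q hℓ hq ha hA
  exact ⟨h.1, by rw [h.2.1, hM], by rw [h.2.2, hm]⟩

/-- below `q = (2;4,0)` only `f = (0;5,1)`. -/
theorem below_q_is_f : ∀ ℓ q : Letter, ℓ.OnAlphabet 6 → q.OnAlphabet 6 → q.a = 2 → absMax q = 4 → absMin q = 0 →
    AmpleAbove ℓ q → ℓ.a = 0 ∧ absMax ℓ = 5 ∧ absMin ℓ = 1 := by
  intro ℓ q hℓ hq ha hM hm hA
  have h := letterFactF3 ℓ q hℓ hq ha hA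
  exact ⟨h.1, by rw [h.2.1, hM], by rw [h.2.2, hm]⟩

/-- **NEGATIVE-SLOT PATTERN LAW** (design level): under (A4) on the height-6 alphabet every present N cell has a present P cell matching
its height-2 pattern slot for slot by the shifted floor pattern. -/
theorem negSlotPatternLaw : ∀ D : Design, D.OnAlphabet 6 → D.A4 → ∀ y ∈ D.suppN, ∃ x ∈ D.suppP,
    ∀ f : Fin 4, (y f).a = 2 → ShiftPattern (x f) (y f) := by
  intro D hA h4 y hy
  obtain ⟨x, hx, hl⟩ := h4.2 y hy
  exact ⟨x, hx, fun f hf => letterFactF3 (x f) (y f) (suppP_onAlphabet hA hx f) (suppN_onAlphabet hA hy f) hf (hl f)⟩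

/-- counting corollary: the matching P cell has at least as many floor slots as the N cell has height-2 slots. -/
theorem floorSlots_ge_twoSlots : ∀ D : Design, D.OnAlphabet 6 → D.A4 → ∀ y ∈ D.suppN, ∃ x ∈ D.suppP,
    (Finset.univ.filter fun f : Fin 4 => (y f).a = 2).card ≤ (Finset.univ.filter fun f : Fin 4 => (x f).a = 0).card := by
  intro D hA h4 y hy
  obtain ⟨x, hx, h⟩ := negSlotPatternLaw D hA h4 y hy
  refine ⟨x, hx, Finset.card_le_card ?_⟩
  intro f hf
  simp only [Finset.mem_filter, Finset.mem_univ, true_and] at hf ⊢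
  exact (h f hf).1

/-- the dual direction for P cells (first conjunct of (A4)): every present P cell lies below some present N cell, and at every slot where
that N cell has height 2 the P cell carries the shifted floor pattern. -/
theorem negSlotPatternLawP : ∀ D : Design, D.OnAlphabet 6 → D.A4 → ∀ x ∈ D.suppP, ∃ y ∈ D.suppN,
    ∀ f : Fin 4, (y f).a = 2 → ShiftPattern (x f) (y f) := by
  intro D hA h4 x hx
  obtain ⟨y, hy, hl⟩ := h4.1 x hx
  exact ⟨y, hy, fun f hf => letterFactF3 (x f) (y f) (suppP_onAlphabet hA hx f) (suppN_onAlphabet hA hy f) hf (hl f)⟩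

end Summit.HodgeConjecture.HodgeConjecture.Cruxes.BlochSeedDiscOne.NegSlotPattern
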